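import Summits.QuantumFields.YangMills.Theorems.ColdStartUniversalityLatticeLangevinHopfLax
import Literature.MathematicalPhysics.QuantumFieldTheory.ShenZhuZhuErgodicity
import Literature.MeasureTheory.OptimalTransport.KantorovichDuality
import Literature.Probability.Divergences.FDivVariational
import HarnessLib

/-!
# TALAGRAND'S QUADRATIC TRANSPORT INEQUALITY FROM ITS DUAL FORM on a compact metric space:
# `∫ e^{Q_C f} dμ ≤ e^{∫f dμ}` for all Lipschitz `f`  ⇒  `W₂(ν, μ)² ≤ 2C·KL(ν ‖ μ)` for every probability measure `ν`

Seat `ym-line-csu-p1` (g42), route `ColdStartUniversality` of `Summits/QuantumFields/YangMills`, helper file G69d (`--supports stmt-QuantumFields-24809`).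
GENERIC (compact metric space `X`, Borel probability measures; instantiated in the sequel with `X = SU(2)^E`, `ρ_L`, `μ = μ_(β')`).  Bakry–Gentil–Ledoux
Prop. 9.2.3: the inequality `∫e^{Q_C f}dμ ≤ e^{∫f dμ}` (`Q_C f = inf_v [f(v) + d(·,v)²/(2C)]`, the Hopf–Lax value at time `C`) is the dual
formulation of `T₂(C)`.  Proof in the tree's vocabulary: for a continuous Kantorovich pair `φ ⊕ ψ ≤ d²`, replace `ψ` by its Lipschitz `c`-transform
(G62 `exists_lipschitz_potential`), put `g = −ψ'/2` so that `φ/2 ≤ Q₁ g` (G62 `half_le_hopfLax_one`); the Gibbs variational inequality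
(`Literature.Probability.Divergences.integral_le_toReal_klDiv_add_integral`, log form) and the dual inequality for `f = g/C` give
`∫Q₁g dν − ∫g dμ ≤ C·KL(ν‖μ)`, hence every dual value is `≤ 2C·KL`; Kantorovich duality (tree) turns this into a coupling.

* ★ `integral_le_klDiv_add_log_integral_exp` — Gibbs / Donsker–Varadhan in log form: `∫g dν ≤ KL(ν‖μ) + log ∫e^g dμ` (continuous `g`);
* ★★★ `szzWassersteinSq_le_klDiv_of_dual` — **`szzWassersteinSq d² ν μ ≤ ofReal(2C·KL(ν‖μ))`** for every probability `ν` with `KL(ν‖μ) < ∞`, under the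
  dual hypothesis for `μ`.

THEOREMS ONLY, no definition, no sorry.  HONEST FRAMING: abstract metric-measure lemmas; nothing here is specific to Yang–Mills; no crux, rung or
summit statement is proved; the Yang–Mills mass gap is NOT proved.
-/

set_option autoImplicit false

noncomputable section

namespace Summit.QuantumFields.YangMills.Theorems.ColdStartUniversality

open MeasureTheory ProbabilityTheory Filter Topology Set Metric InformationTheory
open scoped BigOperators ENNReal
open Literature.MathematicalPhysics.QuantumFieldTheory

variable {X : Type*} [MetricSpace X] [CompactSpace X] [MeasurableSpace X] [BorelSpace X]

/-- ★ **Gibbs variational inequality, log form**: for probability measures `ν, μ` with `KL(ν‖μ) < ∞` and continuous `g`,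
`∫g dν ≤ KL(ν‖μ) + log ∫e^g dμ` (the tree's linearised form at `g − log∫e^g dμ`). [cite: PolyanskiyWu2024, Thm. 7.26] -/
theorem integral_le_klDiv_add_log_integral_exp (ν μ : Measure X) [IsProbabilityMeasure ν] [IsProbabilityMeasure μ]
    (hfin : klDiv ν μ ≠ ∞) {g : X → ℝ} (hg : Continuous g) :
    ∫ x, g x ∂ν ≤ (klDiv ν μ).toReal + Real.log (∫ x, Real.exp (g x) ∂μ) := by
  have hne : Nonempty X := by
    by_contra hX
    rw [not_nonempty_iff] at hX
    have h1 := measure_univ (μ := μ)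
    rw [Set.univ_eq_empty_iff.mpr hX, measure_empty] at h1
    exact zero_ne_one h1
  obtain ⟨c, hc⟩ : ∃ c : ℝ, c = Real.log (∫ x, Real.exp (g x) ∂μ) := ⟨_, rfl⟩
  have hEi : Integrable (fun x => Real.exp (g x)) μ := (Real.continuous_exp.comp hg).integrable_of_hasCompactSupport (HasCompactSupport.of_compactSpace _)
  have hI0 : 0 < ∫ x, Real.exp (g x) ∂μ := by
    obtain ⟨m, hm'⟩ := (isCompact_range (continuous_abs.comp hg)).bddAbove
    have hm : ∀ x, |g x| ≤ m := fun x => hm' ⟨x, rfl⟩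
    calc (0 : ℝ) < ∫ _x, Real.exp (-m) ∂μ := by rw [integral_const, probReal_univ, one_smul]; exact Real.exp_pos _
      _ ≤ ∫ x, Real.exp (g x) ∂μ := integral_mono (integrable_const _) hEi fun x => Real.exp_le_exp.2 (abs_le.1 (hm x)).1
  have hgi : Integrable (fun x => g x - c) ν := (hg.sub continuous_const).integrable_of_hasCompactSupport (HasCompactSupport.of_compactSpace _)
  have hexp : Integrable (fun x => Real.exp (g x - c)) μ :=
    (Real.continuous_exp.comp (hg.sub continuous_const)).integrable_of_hasCompactSupport (HasCompactSupport.of_compactSpace _)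
  have h := Literature.Probability.Divergences.integral_le_toReal_klDiv_add_integral (μ := ν) (ν := μ) hfin hgi hexp
  have h1 : ∫ x, (g x - c) ∂ν = ∫ x, g x ∂ν - c := by
    rw [integral_sub (hg.integrable_of_hasCompactSupport (HasCompactSupport.of_compactSpace _)) (integrable_const c), integral_const, probReal_univ, one_smul]
  have h2 : ∫ x, (Real.exp (g x - c) - 1) ∂μ = 0 := by
    rw [integral_sub hexp (integrable_const _), integral_const, probReal_univ, one_smul]
    have h3 : ∫ x, Real.exp (g x - c) ∂μ = Real.exp (-c) * ∫ x, Real.exp (g x) ∂μ := by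
      rw [← integral_const_mul]
      refine integral_congr_ae (ae_of_all _ fun x => ?_)
      show Real.exp (g x - c) = Real.exp (-c) * Real.exp (g x)
      rw [sub_eq_add_neg, Real.exp_add, mul_comm]
    rw [h3, hc, Real.exp_neg, Real.exp_log hI0, inv_mul_cancel₀ hI0.ne', sub_self]
  rw [h1, h2, add_zero] at h
  rw [← hc]; linarith

/-- ★★★ **Talagrand's `T₂(C)` from its dual form.**  Let `μ` be a Borel probability measure on a compact metric space such that
`∫ e^{Q_C f} dμ ≤ e^{∫f dμ}` for every Lipschitz `f` (`Q_C f(x) = inf_v [f(v) + d(x,v)²/(2C)]`, `C > 0`).  Then for every probability measure `ν` with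
`KL(ν‖μ) < ∞`:  `szzWassersteinSq d² ν μ ≤ ofReal(2C·KL(ν‖μ))`, i.e. `W₂(ν,μ)² ≤ 2C·KL(ν‖μ)` with an optimal coupling. [cite: BakryGentilLedoux2014, Thm 9.6.1] -/
theorem szzWassersteinSq_le_klDiv_of_dual (μ : Measure X) [IsProbabilityMeasure μ] {C : ℝ} (hC : 0 < C)
    (hdual : ∀ (f : X → ℝ) (Lf : ℝ), Continuous f → 0 ≤ Lf → (∀ z w, |f z - f w| ≤ Lf * dist z w) →
      ∫ x, Real.exp (⨅ v, (f v + dist x v ^ 2 / (2 * C))) ∂μ ≤ Real.exp (∫ x, f x ∂μ))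
    (ν : Measure X) [IsProbabilityMeasure ν] (hfin : klDiv ν μ ≠ ∞) :
    szzWassersteinSq (fun x y : X => dist x y ^ 2) ν μ ≤ ENNReal.ofReal (2 * C * (klDiv ν μ).toReal) := by
  have hne : Nonempty X := by
    by_contra hX
    rw [not_nonempty_iff] at hX
    have h1 := measure_univ (μ := μ)
    rw [Set.univ_eq_empty_iff.mpr hX, measure_empty] at h1
    exact zero_ne_one h1
  -- Kantorovich duality for the cost `d²`
  have hcont2 : Continuous fun p : X × X => dist p.1 p.2 ^ 2 := (continuous_dist.comp (continuous_fst.prodMk continuous_snd)).pow 2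
  let c : C(X × X, ℝ) := ⟨fun p => dist p.1 p.2 ^ 2, hcont2⟩
  obtain ⟨π, hπ, hlub⟩ := Literature.MeasureTheory.OptimalTransport.exists_isCoupling_isLUB_integral (μ := ν) (ν := μ)
    (by rw [measure_univ, measure_univ]) c
  -- every dual value is at most `2C·KL`
  have hΔ : ∀ u v : X, dist u v ≤ Metric.diam (Set.univ : Set X) := fun u v =>
    Metric.dist_le_diam_of_mem isCompact_univ.isBounded (Set.mem_univ u) (Set.mem_univ v)
  have hΔ0 : 0 ≤ Metric.diam (Set.univ : Set X) := Metric.diam_nonneg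
  have hub : 2 * C * (klDiv ν μ).toReal ∈ upperBounds (Literature.MeasureTheory.OptimalTransport.dualValues ν μ c) := by
    rintro r ⟨φ, ψ, hφψ, rfl⟩
    obtain ⟨ψ', hψψ', hφψ', hlipψ', hcψ'⟩ := exists_lipschitz_potential (φ := fun x => φ x) (ψ := fun x => ψ x) (fun u v => hφψ u v) hΔ
    -- `g = −ψ'/2`, `f = g/C`
    have hgc : Continuous fun w => -(ψ' w) / 2 / C := ((hcψ'.neg).div_const 2).div_const C
    have hglip : ∀ z w : X, |(-(ψ' z) / 2 / C) - (-(ψ' w) / 2 / C)| ≤ Metric.diam (Set.univ : Set X) / C * dist z w := by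
      intro z w
      have h1 := hlipψ' w z
      rw [show (-(ψ' z) / 2 / C) - (-(ψ' w) / 2 / C) = (ψ' w - ψ' z) / (2 * C) by ring, abs_div, abs_of_pos (by positivity : (0:ℝ) < 2 * C),
        div_le_iff₀ (by positivity)]
      calc |ψ' w - ψ' z| ≤ 2 * Metric.diam (Set.univ : Set X) * dist w z := h1
        _ = Metric.diam (Set.univ : Set X) / C * dist z w * (2 * C) := by rw [dist_comm]; field_simp
    have hd := hdual (fun w => -(ψ' w) / 2 / C) (Metric.diam (Set.univ : Set X) / C) hgc (by positivity) hglip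
    -- `Q_C(g/C) = Q₁ g / C`
    have hQeq : ∀ x, (⨅ v, (-(ψ' v) / 2 / C + dist x v ^ 2 / (2 * C))) = (⨅ v, (-(ψ' v) / 2 + dist x v ^ 2 / (2 * 1))) / C := by
      intro x
      rw [div_eq_inv_mul, Real.mul_iInf_of_nonneg (inv_nonneg.2 hC.le)]
      refine iInf_congr fun v => ?_
      field_simp
    have hQ1c : Continuous fun x => ⨅ v, (-(ψ' v) / 2 + dist x v ^ 2 / (2 * 1)) := by
      have hgc' : Continuous fun w => -(ψ' w) / 2 := (hcψ'.neg).div_const 2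
      have hglip' : ∀ z w : X, |(-(ψ' z) / 2) - (-(ψ' w) / 2)| ≤ Metric.diam (Set.univ : Set X) * dist z w := by
        intro z w
        have h1 := hlipψ' w z
        rw [dist_comm] at h1
        rw [show (-(ψ' z) / 2) - (-(ψ' w) / 2) = (ψ' w - ψ' z) / 2 by ring, abs_div, abs_two]
        linarith
      exact hopfLax_continuous hgc' hΔ0 hglip' one_pos
    -- Gibbs in log form for `Q₁g/C`
    have hgibbs := integral_le_klDiv_add_log_integral_exp ν μ hfin (hQ1c.div_const C)
    have hlogle : Real.log (∫ x, Real.exp ((⨅ v, (-(ψ' v) / 2 + dist x v ^ 2 / (2 * 1))) / C) ∂μ) ≤ ∫ x, (-(ψ' x) / 2 / C) ∂μ := by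
      have hI : ∫ x, Real.exp ((⨅ v, (-(ψ' v) / 2 + dist x v ^ 2 / (2 * 1))) / C) ∂μ = ∫ x, Real.exp (⨅ v, (-(ψ' v) / 2 / C + dist x v ^ 2 / (2 * C))) ∂μ :=
        integral_congr_ae (ae_of_all _ fun x => by show Real.exp _ = Real.exp _; rw [hQeq x])
      rw [hI]
      have hpos : 0 < ∫ x, Real.exp (⨅ v, (-(ψ' v) / 2 / C + dist x v ^ 2 / (2 * C))) ∂μ := by
        rw [← hI]
        have hEi : Integrable (fun x => Real.exp ((⨅ v, (-(ψ' v) / 2 + dist x v ^ 2 / (2 * 1))) / C)) μ :=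
          (Real.continuous_exp.comp (hQ1c.div_const C)).integrable_of_hasCompactSupport (HasCompactSupport.of_compactSpace _)
        obtain ⟨m, hm'⟩ := (isCompact_range (continuous_abs.comp (hQ1c.div_const C))).bddAbove
        have hm : ∀ x, |(⨅ v, (-(ψ' v) / 2 + dist x v ^ 2 / (2 * 1))) / C| ≤ m := fun x => hm' ⟨x, rfl⟩
        calc (0 : ℝ) < ∫ _x, Real.exp (-m) ∂μ := by rw [integral_const, probReal_univ, one_smul]; exact Real.exp_pos _
          _ ≤ _ := integral_mono (integrable_const _) hEi fun x => Real.exp_le_exp.2 (abs_le.1 (hm x)).1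
      calc Real.log (∫ x, Real.exp (⨅ v, (-(ψ' v) / 2 / C + dist x v ^ 2 / (2 * C))) ∂μ) ≤ Real.log (Real.exp (∫ x, (-(ψ' x) / 2 / C) ∂μ)) :=
            Real.log_le_log hpos hd
        _ = ∫ x, (-(ψ' x) / 2 / C) ∂μ := Real.log_exp _
    -- integrals of `φ`, `ψ`, `ψ'`
    have hφi : Integrable (fun x => φ x) ν := φ.continuous.integrable_of_hasCompactSupport (HasCompactSupport.of_compactSpace _)
    have hψi : Integrable (fun x => ψ x) μ := ψ.continuous.integrable_of_hasCompactSupport (HasCompactSupport.of_compactSpace _)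
    have hψ'i : Integrable ψ' μ := hcψ'.integrable_of_hasCompactSupport (HasCompactSupport.of_compactSpace _)
    have hQi : Integrable (fun x => ⨅ v, (-(ψ' v) / 2 + dist x v ^ 2 / (2 * 1))) ν := hQ1c.integrable_of_hasCompactSupport (HasCompactSupport.of_compactSpace _)
    have h1 : ∫ x, φ x ∂ν ≤ 2 * ∫ x, (⨅ v, (-(ψ' v) / 2 + dist x v ^ 2 / (2 * 1))) ∂ν := by
      rw [← integral_const_mul]
      refine integral_mono hφi (hQi.const_mul 2) fun x => ?_
      have := half_le_hopfLax_one hφψ' x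
      show φ x ≤ 2 * ⨅ v, (-(ψ' v) / 2 + dist x v ^ 2 / (2 * 1))
      linarith
    have h2 : ∫ x, ψ x ∂μ ≤ ∫ x, ψ' x ∂μ := integral_mono hψi hψ'i hψψ'
    have h3 : ∫ x, (⨅ v, (-(ψ' v) / 2 + dist x v ^ 2 / (2 * 1))) / C ∂ν = (∫ x, (⨅ v, (-(ψ' v) / 2 + dist x v ^ 2 / (2 * 1))) ∂ν) / C := by
      rw [div_eq_inv_mul, ← integral_const_mul]; exact integral_congr_ae (ae_of_all _ fun x => by ring)
    have h4 : ∫ x, (-(ψ' x) / 2 / C) ∂μ = -(∫ x, ψ' x ∂μ) / (2 * C) := by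
      rw [show (fun x => -(ψ' x) / 2 / C) = fun x => (-1 / (2 * C)) * ψ' x by funext x; ring, integral_const_mul]; ring
    rw [h3] at hgibbs
    rw [h4] at hlogle
    have hgibbs' : (∫ x, (⨅ v, (-(ψ' v) / 2 + dist x v ^ 2 / (2 * 1))) ∂ν) / C ≤ (klDiv ν μ).toReal + -(∫ x, ψ' x ∂μ) / (2 * C) := by
      linarith
    -- combine: `∫Q₁g dν/C ≤ KL − ∫ψ' dμ/(2C)` ⇒ `2∫Q₁g dν + ∫ψ' dμ ≤ 2C·KL`
    have hKL0 : 0 ≤ (klDiv ν μ).toReal := ENNReal.toReal_nonneg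
    have h5 : 2 * ∫ x, (⨅ v, (-(ψ' v) / 2 + dist x v ^ 2 / (2 * 1))) ∂ν + ∫ x, ψ' x ∂μ ≤ 2 * C * (klDiv ν μ).toReal := by
      have h6 := mul_le_mul_of_nonneg_left hgibbs' (by positivity : (0 : ℝ) ≤ 2 * C)
      have e1 : 2 * C * ((∫ x, (⨅ v, (-(ψ' v) / 2 + dist x v ^ 2 / (2 * 1))) ∂ν) / C) = 2 * ∫ x, (⨅ v, (-(ψ' v) / 2 + dist x v ^ 2 / (2 * 1))) ∂ν := by
        field_simp
      have e2 : 2 * C * ((klDiv ν μ).toReal + -(∫ x, ψ' x ∂μ) / (2 * C)) = 2 * C * (klDiv ν μ).toReal - ∫ x, ψ' x ∂μ := by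
        field_simp; ring
      rw [e1, e2] at h6; linarith
    show ∫ x, φ x ∂ν + ∫ x, ψ x ∂μ ≤ 2 * C * (klDiv ν μ).toReal
    linarith
  have hcost : ∫ z, c z ∂π ≤ 2 * C * (klDiv ν μ).toReal := hlub.2 hub
  -- the optimal plan is a coupling in the sense of `szzWassersteinSq`
  have hprob : IsProbabilityMeasure π := by
    constructor
    have h1 : π.map Prod.fst Set.univ = 1 := by rw [hπ.map_fst]; exact measure_univ
    rwa [Measure.map_apply measurable_fst MeasurableSet.univ, Set.preimage_univ] at h1
  have hπ' : Literature.Geometry.Riemannian.IsCoupling ν μ π := ⟨hprob, hπ.map_fst, hπ.map_snd⟩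
  have hρi : Integrable (fun z : X × X => dist z.1 z.2 ^ 2) π := hcont2.integrable_of_hasCompactSupport (HasCompactSupport.of_compactSpace _)
  calc szzWassersteinSq (fun x y : X => dist x y ^ 2) ν μ ≤ ∫⁻ z, ENNReal.ofReal (dist z.1 z.2 ^ 2) ∂π := szzWassersteinSq_le _ hπ'
    _ = ENNReal.ofReal (∫ z, dist z.1 z.2 ^ 2 ∂π) := (ofReal_integral_eq_lintegral_ofReal hρi (ae_of_all _ fun z => sq_nonneg _)).symm
    _ ≤ ENNReal.ofReal (2 * C * (klDiv ν μ).toReal) := ENNReal.ofReal_le_ofReal hcost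

end Summit.QuantumFields.YangMills.Theorems.ColdStartUniversality

end
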